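import Summits.MatrixMultiplication.MatrixMultiplication.Theses.ThinBlockAlpha

/-!
# Box-count necessities for frame designs in `ℤ^D` (crux `ThinPackings`, stmt-MatrixMultiplication-10595)

Negative-side (necessity) lemmas of the deep refuter (drefute) for the design stub `stub_multiRadiusFrames`
of line `label-weighted-stpp-debordering` (and for the sphere line's box designs alike), elementary and
sorry-free.  They are stated on the REGISTERED conjuncts of the stub (packing clause (R1) `c − a = c' − a' →
i = k ∧ …`, the box clause `|v t| ≤ b`, the cardinalities, the count `(6b+1)^D ≤ L·N^{2+η}`), so they apply
verbatim to any witness: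

* `sum_card_mul_card_le_box` / `card_tiles_le_box`: the tiles `c − a` of a family packed by (R1) inside the
  box `[-b, b]^D` are pairwise distinct vectors of `[-2b, 2b]^D`, hence `Σᵢ |Aᵢ||Cᵢ| ≤ (4b+1)^D`, i.e.
  `L·N² ≤ (4b+1)^D` for blocks `⟨N, ·, N⟩`;
* `slack_lower_bound`: together with the two-leg count `(6b+1)^D ≤ L·N^{2+η}` this forces
  `(6b+1)^D ≤ (4b+1)^D · N^η` — the Freiman loss `((6b+1)/(4b+1))^D ≥ 1.4^D` must be absorbed by `N^η`
  (so `N ≥ 1.4^{D/η}`; boxes with `b ≤ 6` can only exhibit `η ≥ 0.3`; `N = 2` needs `η ≥ 0.48·D`).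

None of this refutes the stub; it is the lead's briefing on which toy regimes are void.
-/

set_option linter.dupNamespace false  -- `Summit.<S>.<S>.…` is the mandated namespace

namespace Summit.MatrixMultiplication.MatrixMultiplication.Theorems.ThinPackings.Negative

open Finset

section BoxCount

variable {D L : ℕ}

/-- The doubled box `[-2b, 2b]^D` as a `Finset`, and its cardinality `(4b+1)^D`. [folklore] -/
theorem card_piFinset_Icc_two_mul (D b : ℕ) :
    (Fintype.piFinset fun _ : Fin D => Finset.Icc (-(2 * b : ℤ)) (2 * b)).card = (4 * b + 1) ^ D := by
  rw [Fintype.card_piFinset, Finset.prod_const, Finset.card_univ, Fintype.card_fin]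
  congr 1
  rw [Int.card_Icc]
  have : (2 * b : ℤ) + 1 - -(2 * b : ℤ) = ((4 * b + 1 : ℕ) : ℤ) := by push_cast; ring
  rw [this]
  rfl

/-- A difference of two box vectors lies in the doubled box. [folklore] -/
theorem sub_mem_piFinset_Icc {b : ℕ} {a c : Fin D → ℤ} (ha : ∀ t, |a t| ≤ (b : ℤ))
    (hc : ∀ t, |c t| ≤ (b : ℤ)) :
    c - a ∈ Fintype.piFinset fun _ : Fin D => Finset.Icc (-(2 * b : ℤ)) (2 * b) := by
  rw [Fintype.mem_piFinset]
  intro t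
  have h1 := abs_le.1 (ha t)
  have h2 := abs_le.1 (hc t)
  simp only [Finset.mem_Icc, Pi.sub_apply]
  constructor <;> linarith [h1.1, h1.2, h2.1, h2.2]

/-- **Tile box count.**  If the tiles `c − a` (`a ∈ A i`, `c ∈ C i`) are packed by clause (R1) and all legs lie in
the box `[-b, b]^D`, then `Σᵢ |A i|·|C i| ≤ (4b+1)^D`. [new, elementary] -/
theorem sum_card_mul_card_le_box {b : ℕ} (A C : Fin L → Finset (Fin D → ℤ))
    (hR1 : ∀ i k, ∀ a ∈ A i, ∀ c ∈ C i, ∀ a' ∈ A k, ∀ c' ∈ C k, c - a = c' - a' → i = k ∧ a = a' ∧ c = c')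
    (hA : ∀ i, ∀ v ∈ A i, ∀ t, |v t| ≤ (b : ℤ)) (hC : ∀ i, ∀ v ∈ C i, ∀ t, |v t| ≤ (b : ℤ)) :
    ∑ i, (A i).card * (C i).card ≤ (4 * b + 1) ^ D := by
  classical
  set dom : Finset (Σ _ : Fin L, (Fin D → ℤ) × (Fin D → ℤ)) := univ.sigma fun i => A i ×ˢ C i with hdom
  set f : (Σ _ : Fin L, (Fin D → ℤ) × (Fin D → ℤ)) → (Fin D → ℤ) := fun x => x.2.2 - x.2.1 with hf
  have hinj : Set.InjOn f ↑dom := by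
    rintro ⟨i, a, c⟩ hx ⟨k, a', c'⟩ hy he
    simp only [hdom, coe_sigma, Set.mem_sigma_iff, coe_univ, Set.mem_univ, true_and, coe_product,
      Set.mem_prod, mem_coe] at hx hy
    change c - a = c' - a' at he
    obtain ⟨rfl, rfl, rfl⟩ := hR1 i k a hx.1 c hx.2 a' hy.1 c' hy.2 he
    rfl
  have himg : dom.image f ⊆ Fintype.piFinset fun _ : Fin D => Finset.Icc (-(2 * b : ℤ)) (2 * b) := by
    intro v hv
    rw [mem_image] at hv
    obtain ⟨⟨i, a, c⟩, hx, rfl⟩ := hv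
    simp only [hdom, mem_sigma, mem_univ, true_and, mem_product] at hx
    exact sub_mem_piFinset_Icc (hA i a hx.1) (hC i c hx.2)
  calc ∑ i, (A i).card * (C i).card = dom.card := by
        rw [hdom, card_sigma]; simp only [card_product]
    _ = (dom.image f).card := (card_image_of_injOn hinj).symm
    _ ≤ (Fintype.piFinset fun _ : Fin D => Finset.Icc (-(2 * b : ℤ)) (2 * b)).card := card_le_card himg
    _ = (4 * b + 1) ^ D := card_piFinset_Icc_two_mul D b

/-- **`L·N² ≤ (4b+1)^D`** for blocks `⟨N, ·, N⟩` packed by (R1) inside `[-b, b]^D`. [new, elementary] -/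
theorem card_tiles_le_box {b N : ℕ} (A C : Fin L → Finset (Fin D → ℤ))
    (hR1 : ∀ i k, ∀ a ∈ A i, ∀ c ∈ C i, ∀ a' ∈ A k, ∀ c' ∈ C k, c - a = c' - a' → i = k ∧ a = a' ∧ c = c')
    (hA : ∀ i, ∀ v ∈ A i, ∀ t, |v t| ≤ (b : ℤ)) (hC : ∀ i, ∀ v ∈ C i, ∀ t, |v t| ≤ (b : ℤ))
    (hcard : ∀ i, (A i).card = N ∧ (C i).card = N) : L * N ^ 2 ≤ (4 * b + 1) ^ D := by
  have h := sum_card_mul_card_le_box A C hR1 hA hC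
  have hs : ∑ i, (A i).card * (C i).card = L * N ^ 2 := by
    rw [Finset.sum_congr rfl fun i _ => by rw [(hcard i).1, (hcard i).2], sum_const, card_univ,
      Fintype.card_fin, smul_eq_mul, sq]
  omega

/-- **The Freiman loss must be absorbed by the slack.**  For any family as above that is two-leg tight for
the host `(ℤ/(6b+1))^D` up to `N^η` — the count conjunct `(6b+1)^D ≤ L·N^{2+η}` of the design stubs — one has
`(6b+1)^D ≤ (4b+1)^D · N^η`; in particular `N^η ≥ (7/5)^D` once `b ≥ 1`. [new, elementary] -/
theorem slack_lower_bound {b N : ℕ} {η : ℝ} (hη : 0 < η) (A C : Fin L → Finset (Fin D → ℤ))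
    (hR1 : ∀ i k, ∀ a ∈ A i, ∀ c ∈ C i, ∀ a' ∈ A k, ∀ c' ∈ C k, c - a = c' - a' → i = k ∧ a = a' ∧ c = c')
    (hA : ∀ i, ∀ v ∈ A i, ∀ t, |v t| ≤ (b : ℤ)) (hC : ∀ i, ∀ v ∈ C i, ∀ t, |v t| ≤ (b : ℤ))
    (hcard : ∀ i, (A i).card = N ∧ (C i).card = N)
    (hcount : (((6 * b + 1 : ℕ) : ℝ)) ^ D ≤ L * (N : ℝ) ^ (2 + η)) :
    (((6 * b + 1 : ℕ) : ℝ)) ^ D ≤ (((4 * b + 1 : ℕ) : ℝ)) ^ D * (N : ℝ) ^ η := by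
  have hbox := card_tiles_le_box A C hR1 hA hC hcard
  have hboxR : (L : ℝ) * (N : ℝ) ^ 2 ≤ (((4 * b + 1 : ℕ) : ℝ)) ^ D := by exact_mod_cast hbox
  have hN0 : (0 : ℝ) ≤ N := Nat.cast_nonneg N
  have hsplit : (N : ℝ) ^ (2 + η) = (N : ℝ) ^ 2 * (N : ℝ) ^ η := by
    rcases Nat.eq_zero_or_pos N with hN | hN
    · subst hN
      have h2η : (2 + η) ≠ 0 := by linarith
      have hη' : η ≠ 0 := ne_of_gt hη
      simp [Real.zero_rpow h2η, Real.zero_rpow hη']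
    · have hNpos : (0 : ℝ) < N := by exact_mod_cast hN
      rw [Real.rpow_add hNpos, Real.rpow_two]
  have hη0 : (0 : ℝ) ≤ (N : ℝ) ^ η := Real.rpow_nonneg hN0 η
  calc (((6 * b + 1 : ℕ) : ℝ)) ^ D ≤ L * (N : ℝ) ^ (2 + η) := hcount
    _ = (L : ℝ) * (N : ℝ) ^ 2 * (N : ℝ) ^ η := by rw [hsplit, mul_assoc]
    _ ≤ (((4 * b + 1 : ℕ) : ℝ)) ^ D * (N : ℝ) ^ η := mul_le_mul_of_nonneg_right hboxR hη0

end BoxCount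

end Summit.MatrixMultiplication.MatrixMultiplication.Theorems.ThinPackings.Negative
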